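import Literature.Analysis.Calculus.JacobianNullLagrangian
import Mathlib.MeasureTheory.Integral.DivergenceTheorem
import Mathlib.Analysis.Normed.Module.FiniteDimension
import HarnessLib

/-!
# The divergence theorem on a period box: `∫ div W = 0` for periodic `W`

Topic `Literature/Analysis/Calculus`. Let `ℝⁿ⁺¹ = Fin (n+1) → ℝ`, `T > 0` and
`K = [a, a + T]` a closed period box. For a continuous vector field `W : ℝⁿ⁺¹ → ℝⁿ⁺¹` that is
differentiable everywhere and `T`-periodic in each coordinate, the front- and back-face fluxes in
Mathlib's divergence theorem on boxes (`MeasureTheory.integral_divergence_of_hasFDerivAt_off_countable`)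
cancel, so `∫_K div W = 0` (`integral_divergence_eq_zero_of_periodic`): this is the statement that
the integral of an exact top form over the flat torus `ℝⁿ⁺¹ / Tℤⁿ⁺¹` vanishes (Stokes on a closed
manifold), in the only case this tree needs.

Combined with the null-Lagrangian identity of
`Literature/Analysis/Calculus/JacobianNullLagrangian.lean` this gives the key step of the
analytic construction of the Brouwer degree on the torus (Chang, *Methods in Nonlinear Analysis*
(2005), §3.1, Lemma 3.1.3 and Thm. 3.1.4, there on a domain with `supp ⊆ Y ∖ f(∂X)`; here
periodicity replaces the boundary condition):

* `integral_divG_comp_mul_det_eq_zero_of_contDiff` — for a `C²` coordinatewise `T`-periodic map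
  `f : ℝⁿ⁺¹ → ℝⁿ⁺¹` and a differentiable field `G` with continuous divergence `ψ = div G`,
  `∫_K ψ(f x) · det Df(x) dx = 0`.

The `C¹` version (by mollification) is in `Literature/Analysis/Calculus/PeriodicMollifier.lean`;
the application (index sum of a periodic vector field, Poincaré–Hopf on the torus) in
`Literature/Topology/Euclidean/PoincareHopfTorus.lean`. No definitions, no `sorry`.

## References

* K.-C. Chang, *Methods in Nonlinear Analysis* (2005), §3.1, Lemma 3.1.3, Thm. 3.1.4. [Chang2005]
-/

noncomputable section

open MeasureTheory Set Function

namespace Literature.Analysis.Calculus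

variable {n : ℕ}

/-- Inserting `s + t` as the `i`-th coordinate is inserting `s` and adding `t eᵢ`. [folklore] -/
theorem insertNth_add_eq (i : Fin (n + 1)) (s t : ℝ) (y : Fin n → ℝ) :
    (Fin.insertNth i (s + t) y : Fin (n + 1) → ℝ) = Fin.insertNth i s y + Pi.single i t := by
  ext k
  rcases Fin.eq_self_or_eq_succAbove i k with rfl | ⟨j, rfl⟩
  · simp [Fin.insertNth_apply_same]
  · simp [Fin.insertNth_apply_succAbove]

/-- **Divergence theorem on a period box.** If `W : ℝⁿ⁺¹ → ℝⁿ⁺¹` is continuous, differentiable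
everywhere with derivative `W'`, `T`-periodic in each coordinate (`W (x + T eᵢ) = W x`), and its
divergence `∑ᵢ (W' x eᵢ)ᵢ` is integrable on the period box `K = [a, a + T]`, then
`∫_K div W = 0`: in Mathlib's divergence theorem on the box the integrals over the front face
`xᵢ = aᵢ + T` and the back face `xᵢ = aᵢ` coincide by periodicity. [folklore] -/
theorem integral_divergence_eq_zero_of_periodic {T : ℝ} (hT : 0 ≤ T) (a : Fin (n + 1) → ℝ)
    (W : (Fin (n + 1) → ℝ) → Fin (n + 1) → ℝ)
    (W' : (Fin (n + 1) → ℝ) → (Fin (n + 1) → ℝ) →L[ℝ] Fin (n + 1) → ℝ)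
    (hc : Continuous W) (hd : ∀ x, HasFDerivAt W (W' x) x)
    (hper : ∀ x i, W (x + Pi.single i T) = W x)
    (hi : IntegrableOn (fun x => ∑ i, W' x (Pi.single i 1) i) (Icc a (fun i => a i + T))) :
    ∫ x in Icc a (fun i => a i + T), ∑ i, W' x (Pi.single i 1) i = 0 := by
  have hle : a ≤ fun i => a i + T := fun i => le_add_of_nonneg_right hT
  rw [integral_divergence_of_hasFDerivAt_off_countable a (fun i => a i + T) hle W W' ∅
    countable_empty hc.continuousOn (fun x _ => hd x) hi]
  refine Finset.sum_eq_zero fun i _ => ?_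
  have hface : ∀ y : Fin n → ℝ,
      W (Fin.insertNth i (a i + T) y) i = W (Fin.insertNth i (a i) y) i := by
    intro y
    rw [insertNth_add_eq, hper]
  simp_rw [hface, sub_self]

/-- Periodicity of `f` passes to its derivative. [folklore] -/
theorem fderiv_periodic_of_periodic {E F : Type*} [NormedAddCommGroup E] [NormedSpace ℝ E]
    [NormedAddCommGroup F] [NormedSpace ℝ F] {f : E → F} {v : E} (hper : ∀ x, f (x + v) = f x)
    (x : E) : fderiv ℝ f (x + v) = fderiv ℝ f x := by
  rw [← fderiv_comp_add_right v]
  exact congrArg (fun g => fderiv ℝ g x) (funext hper)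

/-- **The degree integrand of a `C²` periodic map integrates to zero against a divergence.**
Let `f : ℝⁿ⁺¹ → ℝⁿ⁺¹` be `C²` and `T`-periodic in each coordinate, `G : ℝⁿ⁺¹ → ℝⁿ⁺¹`
differentiable with continuous divergence `ψ = ∑ᵢ ∂ᵢ Gᵢ`. Then
`∫_{[a, a+T]} ψ(f x) · det Df(x) dx = 0`. Proof: `ψ(f) det Df = div W` for the periodic Piola
field `W = adj(Df) · G∘f` (`sum_fderiv_piolaField`), and `∫ div W = 0` on a period box
(`integral_divergence_eq_zero_of_periodic`). (Chang 2005, Lemma 3.1.3 with Thm. 3.1.4, where the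
boundary term is killed by a support condition instead of periodicity.)
[cite: Chang2005, Lemma 3.1.3 and Thm 3.1.4] -/
theorem integral_divG_comp_mul_det_eq_zero_of_contDiff {T : ℝ} (hT : 0 ≤ T)
    (a : Fin (n + 1) → ℝ) {f : (Fin (n + 1) → ℝ) → Fin (n + 1) → ℝ} (hf : ContDiff ℝ 2 f)
    (hper : ∀ x i, f (x + Pi.single i T) = f x)
    {G : (Fin (n + 1) → ℝ) → Fin (n + 1) → ℝ} (hG : Differentiable ℝ G)
    {ψ : (Fin (n + 1) → ℝ) → ℝ} (hψ : Continuous ψ)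
    (hGψ : ∀ v, ∑ i, fderiv ℝ G v (Pi.single i 1) i = ψ v) :
    ∫ x in Icc a (fun i => a i + T), ψ (f x) * (fderiv ℝ f x).det = 0 := by
  set W : (Fin (n + 1) → ℝ) → Fin (n + 1) → ℝ := piolaField f G with hW
  have hfx : ∀ x, ContDiffAt ℝ 2 f x := fun x => hf.contDiffAt
  have hdW : ∀ x, HasFDerivAt W (fderiv ℝ W x) x := fun x =>
    (hasFDerivAt_piolaField (hfx x) (hG (f x))).differentiableAt.hasFDerivAt
  have hdiv : ∀ x, ∑ i, fderiv ℝ W x (Pi.single i 1) i = ψ (f x) * (fderiv ℝ f x).det := by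
    intro x
    rw [hW, sum_fderiv_piolaField (hfx x) (hG (f x)), hGψ]
  -- continuity of the Piola field
  have hfd1 : Continuous (fderiv ℝ f) := hf.continuous_fderiv (by norm_num)
  have hcW : Continuous W := by
    refine continuous_pi fun j => continuous_finsetSum _ fun i _ => ?_
    refine Continuous.mul ?_ ((continuous_apply i).comp (hG.continuous.comp hf.continuous))
    change Continuous fun x => detRowsCLM (Fin (n + 1)) (update (jacCols f x) j (Pi.single i 1))
    refine (detRowsCLM (Fin (n + 1))).cont.comp ?_
    refine continuous_pi fun k => ?_
    by_cases hkj : k = j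
    · subst hkj
      simp only [update_self]
      exact continuous_const
    · simp only [update_of_ne hkj, jacCols]
      exact hfd1.clm_apply continuous_const
  -- periodicity of the Piola field
  have hperW : ∀ x i, W (x + Pi.single i T) = W x := by
    intro x i
    have hJ : jacCols f (x + Pi.single i T) = jacCols f x := by
      funext k
      simp only [jacCols, fderiv_periodic_of_periodic (fun y => hper y i) x]
    funext j
    simp only [hW, piolaField, jacCofactor, hJ, hper]
  -- integrability of the divergence
  have hint : IntegrableOn (fun x => ∑ i, fderiv ℝ W x (Pi.single i 1) i)
      (Icc a (fun i => a i + T)) := by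
    simp_rw [hdiv]
    exact ((hψ.comp hf.continuous).mul
      (ContinuousLinearMap.continuous_det.comp hfd1)).integrableOn_Icc
  have h := integral_divergence_eq_zero_of_periodic hT a W (fun x => fderiv ℝ W x) hcW hdW hperW
    hint
  simp_rw [hdiv] at h
  exact h

end Literature.Analysis.Calculus
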